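import Summits.QuantumFields.YangMills.Theorems.UnitScaleTiltHalvingP1FlatCoreFrameLinReal
import HarnessLib

/-!
# The effective-gauge tower in log coordinates — LOCAL form of the reality row `C(−μ⋆) = −C(μ)⋆` (J-N05♭ `core′`, F4-local)

Sub-problem `YangMills` of summit `QuantumFields`; route `UnitScaleTilt`, line H = `BirthV10.stub_halvingStep`, pillar P1♭ `core′`
(LEAD-H T2♭-PLAN v1.1; rulings L-3/L-4/L-5).  Helper file (`--supports stmt-QuantumFields-19200 --as helper`); it closes no item.
HONEST LABEL: YM₃ on `T³` is rung R3 of the ladder, NOT the Clay problem; nothing here is a mass-gap statement.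

## What this file adds

✓`P1FlatCoreFrameLinReal.effGauge_negStar` / `Cnl_negStar` ask unitarity and the disc conditions for every block of every level; the
`hCreal` row of ✓`hFP_kLevel_family_RD` supplies them only on the (1.120)-box under the evaluation site.  Here they are asked on a
user-supplied family of site sets `S j ⊆ T^{(j)}` closed under «centre and stair ends of a block of `S (j+1)` lie in `S j`», with the
conclusion on `S`:  ★★ `effGauge_negStar_local`, ★★★ `Cnl_negStar_local`.

[cite: Balaban1985RegularSpaces, Sect. E (1.111), (1.116) pp.95-96; Balaban1985Averaging, (97)-(100) p.32, (110) p.34]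
-/

noncomputable section

open NormedSpace
open Literature.MathematicalPhysics.QuantumFieldTheory.Balaban1983to89
open T4Continuum BlockAveraging ExpMeanLog MatrixLog
open B10Eq27TorusAxialLog (holT gaugeActT)
open B7TransferAnalyticMean (meanCLM meanCLM_apply)
open B7Prop1Explicit (units_val_inv_eq_exp_neg)
open LatticeFieldCalculus (siteAvg siteAvgIter)
open Summit.QuantumFields.YangMills.Theorems.Prop8ChartDoubleBar (vframeU dbarIterU)
open Summit.QuantumFields.YangMills.Theorems.P1FlatCoreFrameLin (coe_vframeU_eq_exp_meanCLM)
open Summit.QuantumFields.YangMills.Theorems.P1FlatCoreFrameLinTower (effGauge_step_eq_eml)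
open Summit.QuantumFields.YangMills.Theorems.P1FlatCoreFrameLinLipschitz (val_unit_eml val_inv_unit_eml)
open Summit.QuantumFields.YangMills.Theorems.P1FlatCoreFrameLinReal (mlog_star_of_le mlog_star_units_inv units_val_inv_eq_star star_meanCLM
  siteAvgIter_negStar)
open Summit.QuantumFields.BalabanUV.T4Continuum.BlockAverageLoopLog (mlog_units_inv)

namespace Summit.QuantumFields.YangMills.Theorems.P1FlatCoreFrameLinRealLocal

/-! ## §1 The reality row, LOCAL (C⋆-algebra letters) -/

section Real

variable {𝔸 : Type*} [CStarAlgebra 𝔸]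
variable {P : Params}

/-- **★★ THE TOWER OF `−μ⋆` IS THE STAR-INVERSE OF THE TOWER OF `μ`, LOCAL** (✓`effGauge_negStar` with `hWu`/`hWs`/`hdisc` asked only for
blocks in `S (i+1)`, conclusion on `S i`). [cite: Balaban1985RegularSpaces, (1.111), (1.116) pp.95-96; Balaban1985Averaging, (97)-(100) p.32] -/
theorem effGauge_negStar_local (W : GaugeField P 0 𝔸ˣ) (κf : (Site P 0 → 𝔸) → (i : ℕ) → GaugeTransf P i 𝔸ˣ)
    (hs : ∀ (m : Site P 0 → 𝔸) (i : ℕ) (y : Site P (i + 1)),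
      κf m (i + 1) y = (vframeU (gaugeActT (κf m i) (dbarIterU i W)) y)⁻¹ * κf m i (emb y) * vframeU (dbarIterU i W) y)
    (h0 : ∀ (m : Site P 0 → 𝔸) (x : Site P 0), ((κf m 0 x : 𝔸ˣ) : 𝔸) = exp (m x))
    (μ : Site P 0 → 𝔸) (k : ℕ) (S : (j : ℕ) → Set (Site P j))
    (hSe : ∀ j < k, ∀ y ∈ S (j + 1), emb y ∈ S j)
    (hSs : ∀ j < k, ∀ y ∈ S (j + 1), ∀ idx : Idx P, walkEnd (emb y) (stairWord idx.2.1 (off idx.1)) ∈ S j)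
    (hWu : ∀ i < k, ∀ y ∈ S (i + 1), ∀ idx : Idx P,
      ((holT (dbarIterU i W) (emb y) (stairWord idx.2.1 (off idx.1)) : 𝔸ˣ) : 𝔸) ∈ unitary 𝔸)
    (hWs : ∀ i < k, ∀ y ∈ S (i + 1), ∀ idx : Idx P,
      ‖((holT (dbarIterU i W) (emb y) (stairWord idx.2.1 (off idx.1)) : 𝔸ˣ) : 𝔸) - 1‖ ≤ 1 / 12)
    (hdisc : ∀ i < k, ∀ y ∈ S (i + 1), ∀ idx : Idx P,
      ‖((holT (dbarIterU i W) (emb y) (stairWord idx.2.1 (off idx.1)) *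
          ((κf μ i (walkEnd (emb y) (stairWord idx.2.1 (off idx.1))))⁻¹ * κf μ i (emb y)) : 𝔸ˣ) : 𝔸) - 1‖ ≤ 1 / 12) :
    ∀ i ≤ k, ∀ x ∈ S i,
      ((κf (fun z => -star (μ z)) i x : 𝔸ˣ) : 𝔸) = star ((((κf μ i x)⁻¹ : 𝔸ˣ) : 𝔸)) ∧
        ((((κf (fun z => -star (μ z)) i x)⁻¹ : 𝔸ˣ) : 𝔸)) = star ((κf μ i x : 𝔸ˣ) : 𝔸) := by
  intro i
  induction i with
  | zero =>
    intro _ x _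
    refine ⟨?_, ?_⟩
    · rw [h0, units_val_inv_eq_exp_neg (h0 μ x), star_exp, star_neg]
    · rw [units_val_inv_eq_exp_neg (h0 _ x), h0, star_exp, neg_neg]
  | succ i ih =>
    intro hik y hy
    have hi : i < k := Nat.lt_of_succ_le hik
    have ihi := ih hi.le
    have hye : emb y ∈ S i := hSe i hi y hy
    have hys : ∀ idx : Idx P, walkEnd (emb y) (stairWord idx.2.1 (off idx.1)) ∈ S i := hSs i hi y hy
    -- the two eml families: `fam′ = (fam⁻¹)⋆` termwise
    have hfam : ∀ idx : Idx P,
        ((holT (dbarIterU i W) (emb y) (stairWord idx.2.1 (off idx.1)) : 𝔸ˣ) : 𝔸) *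
            ((((κf (fun z => -star (μ z)) i (walkEnd (emb y) (stairWord idx.2.1 (off idx.1))))⁻¹ *
                κf (fun z => -star (μ z)) i (emb y) : 𝔸ˣ)) : 𝔸) =
          star (((((holT (dbarIterU i W) (emb y) (stairWord idx.2.1 (off idx.1)) *
            ((κf μ i (walkEnd (emb y) (stairWord idx.2.1 (off idx.1))))⁻¹ * κf μ i (emb y)))⁻¹ : 𝔸ˣ)) : 𝔸)) := by
      intro idx
      rw [Units.val_mul, (ihi _ (hys idx)).2, (ihi _ hye).1, mul_inv_rev, mul_inv_rev, inv_inv, Units.val_mul, Units.val_mul,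
        units_val_inv_eq_star (hWu i hi y hy idx), star_mul, star_mul, star_star]
    have hlog : ∀ idx : Idx P,
        mlog (((holT (dbarIterU i W) (emb y) (stairWord idx.2.1 (off idx.1)) : 𝔸ˣ) : 𝔸) *
            ((((κf (fun z => -star (μ z)) i (walkEnd (emb y) (stairWord idx.2.1 (off idx.1))))⁻¹ *
                κf (fun z => -star (μ z)) i (emb y) : 𝔸ˣ)) : 𝔸)) =
          -star (mlog (((holT (dbarIterU i W) (emb y) (stairWord idx.2.1 (off idx.1)) : 𝔸ˣ) : 𝔸) *
            ((((κf μ i (walkEnd (emb y) (stairWord idx.2.1 (off idx.1))))⁻¹ * κf μ i (emb y) : 𝔸ˣ)) : 𝔸))) := by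
      intro idx
      rw [hfam idx, mlog_star_units_inv (hdisc i hi y hy idx), Units.val_mul]
    -- the exponents: `M′ = −M⋆`
    have hM : (meanCLM (Idx P) 𝔸 fun idx : Idx P =>
        mlog (((holT (dbarIterU i W) (emb y) (stairWord idx.2.1 (off idx.1)) : 𝔸ˣ) : 𝔸) *
            ((((κf (fun z => -star (μ z)) i (walkEnd (emb y) (stairWord idx.2.1 (off idx.1))))⁻¹ *
                κf (fun z => -star (μ z)) i (emb y) : 𝔸ˣ)) : 𝔸))) =
          -star (meanCLM (Idx P) 𝔸 fun idx : Idx P =>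
            mlog (((holT (dbarIterU i W) (emb y) (stairWord idx.2.1 (off idx.1)) : 𝔸ˣ) : 𝔸) *
              ((((κf μ i (walkEnd (emb y) (stairWord idx.2.1 (off idx.1))))⁻¹ * κf μ i (emb y) : 𝔸ˣ)) : 𝔸))) := by
      rw [star_meanCLM, ← map_neg]
      congr 1
      funext idx
      rw [Pi.neg_apply, hlog idx]
    -- the frame `v = v(X_i)(y)` is unitary: `(v⁻¹)⋆ = v`
    have hH : (meanCLM (Idx P) 𝔸 fun idx : Idx P =>
        mlog (((holT (dbarIterU i W) (emb y) (stairWord idx.2.1 (off idx.1)) : 𝔸ˣ) : 𝔸))) =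
          -star (meanCLM (Idx P) 𝔸 fun idx : Idx P =>
            mlog (((holT (dbarIterU i W) (emb y) (stairWord idx.2.1 (off idx.1)) : 𝔸ˣ) : 𝔸))) := by
      rw [star_meanCLM, ← map_neg]
      congr 1
      funext idx
      rw [Pi.neg_apply, ← mlog_star_of_le ((hWs i hi y hy idx).trans (by norm_num)), ← units_val_inv_eq_star (hWu i hi y hy idx),
        mlog_units_inv ((hWs i hi y hy idx).trans (by norm_num)), neg_neg]
    have hv : star ((((vframeU (dbarIterU i W) y)⁻¹ : 𝔸ˣ) : 𝔸)) = ((vframeU (dbarIterU i W) y : 𝔸ˣ) : 𝔸) := by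
      rw [units_val_inv_eq_exp_neg (coe_vframeU_eq_exp_meanCLM (dbarIterU i W) y), coe_vframeU_eq_exp_meanCLM, star_exp,
        star_neg, ← neg_eq_iff_eq_neg.mpr hH, neg_neg]
    have hv' : star ((vframeU (dbarIterU i W) y : 𝔸ˣ) : 𝔸) = ((((vframeU (dbarIterU i W) y)⁻¹ : 𝔸ˣ) : 𝔸)) := by
      rw [← hv, star_star]
    refine ⟨?_, ?_⟩
    · rw [effGauge_step_eq_eml W _ (hs _) i y, effGauge_step_eq_eml W _ (hs _) i y, Units.val_mul, Units.val_mul,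
        mul_inv_rev, mul_inv_rev, inv_inv, Units.val_mul, Units.val_mul, star_mul, star_mul, (ihi _ hye).1, val_inv_unit_eml,
        val_unit_eml, star_exp, hM, neg_neg, hv]
    · rw [effGauge_step_eq_eml W _ (hs _) i y, effGauge_step_eq_eml W _ (hs _) i y, mul_inv_rev, mul_inv_rev, inv_inv,
        Units.val_mul, Units.val_mul, Units.val_mul, Units.val_mul, star_mul, star_mul, (ihi _ hye).2, val_unit_eml,
        val_inv_unit_eml, star_exp, star_neg, hM, hv']


/-- **★★★ THE REALITY ROW `C(−μ⋆) = −C(μ)⋆`, LOCAL** (the `hCreal` text of ✓`hFP_kLevel_family_RD` with data read on `S` only).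
[cite: Balaban1985RegularSpaces, Sect. E (1.111), (1.116) pp.95-96] -/
theorem Cnl_negStar_local (W : GaugeField P 0 𝔸ˣ) (κf : (Site P 0 → 𝔸) → (i : ℕ) → GaugeTransf P i 𝔸ˣ)
    (hs : ∀ (m : Site P 0 → 𝔸) (i : ℕ) (y : Site P (i + 1)),
      κf m (i + 1) y = (vframeU (gaugeActT (κf m i) (dbarIterU i W)) y)⁻¹ * κf m i (emb y) * vframeU (dbarIterU i W) y)
    (h0 : ∀ (m : Site P 0 → 𝔸) (x : Site P 0), ((κf m 0 x : 𝔸ˣ) : 𝔸) = exp (m x))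
    (μ : Site P 0 → 𝔸) (k : ℕ) (S : (j : ℕ) → Set (Site P j))
    (hSe : ∀ j < k, ∀ y ∈ S (j + 1), emb y ∈ S j)
    (hSs : ∀ j < k, ∀ y ∈ S (j + 1), ∀ idx : Idx P, walkEnd (emb y) (stairWord idx.2.1 (off idx.1)) ∈ S j)
    (hWu : ∀ i < k, ∀ y ∈ S (i + 1), ∀ idx : Idx P,
      ((holT (dbarIterU i W) (emb y) (stairWord idx.2.1 (off idx.1)) : 𝔸ˣ) : 𝔸) ∈ unitary 𝔸)
    (hWs : ∀ i < k, ∀ y ∈ S (i + 1), ∀ idx : Idx P,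
      ‖((holT (dbarIterU i W) (emb y) (stairWord idx.2.1 (off idx.1)) : 𝔸ˣ) : 𝔸) - 1‖ ≤ 1 / 12)
    (hdisc : ∀ i < k, ∀ y ∈ S (i + 1), ∀ idx : Idx P,
      ‖((holT (dbarIterU i W) (emb y) (stairWord idx.2.1 (off idx.1)) *
          ((κf μ i (walkEnd (emb y) (stairWord idx.2.1 (off idx.1))))⁻¹ * κf μ i (emb y)) : 𝔸ˣ) : 𝔸) - 1‖ ≤ 1 / 12)
    (y : Site P k) (hy : y ∈ S k) (htop : ‖((κf μ k y : 𝔸ˣ) : 𝔸) - 1‖ ≤ 1 / 12) :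
    mlog ((κf (fun z => -star (μ z)) k y : 𝔸ˣ) : 𝔸) - siteAvgIter k (fun z => -star (μ z)) y =
      -star (mlog ((κf μ k y : 𝔸ˣ) : 𝔸) - siteAvgIter k μ y) := by
  rw [(effGauge_negStar_local W κf hs h0 μ k S hSe hSs hWu hWs hdisc k le_rfl y hy).1, mlog_star_units_inv htop, siteAvgIter_negStar μ k y,
    star_sub]
  abel


end Real

end Summit.QuantumFields.YangMills.Theorems.P1FlatCoreFrameLinRealLocal

end
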